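import Summits.BirchSwinnertonDyer.BirchSwinnertonDyer.Theorems.SignedBaseChangeAnticyclotomicEisensteinDivisibilityNoPseudoNullOfBricks
import Summits.BirchSwinnertonDyer.BirchSwinnertonDyer.Theorems.SignedBaseChangeAnticyclotomicEisensteinDivisibilityFiniteExponentTelescope
import Summits.BirchSwinnertonDyer.BirchSwinnertonDyer.Theorems.SignedBaseChangeAnticyclotomicEisensteinDivisibilityCofreeTateDual
import HarnessLib

/-!
# Crux `AnticyclotomicEisensteinDivisibility` (stmt-BirchSwinnertonDyer-20727), line `bdpline`, stub
# `stub_finiteExponentSS`, Greenberg-2016 road: brick (R1a) DISCHARGED in the assembly — `X_Gr(E/K̃_∞)` has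
# no non-zero pseudo-null `Λ₂`-submodule (and `X_Gr₂[T₁]` has finite exponent at `(T₁) ∉ Supp`) GRANTED
# ONLY the six published facts, the line's torsion input and brick (R1b) (helper for stmt-BirchSwinnertonDyer-20727)

Cell `bsd-ssimc` (hosting route `SignedBaseChange`), extra width seat `bsd-line-sbc-p1-w3` (gen 0); second
file of the lane. The width seat `bsd-line-sbc-p1-w2` (gen 3) proved
`SignedBaseChangeAcDivNoPseudoNull.xGr₂_hasNoPseudoNullSubmodule_of_bricks` /
`xGr₂_torsionBy_X_finiteExponent_of_bricks` (p627602): the conclusion of the registered stub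
`stub_finiteExponentSS` for an elliptic `W/K` (`K` imaginary quadratic, `p > 2` split, a generator pair)
granted the six PUBLISHED facts (Greenberg 2016 Props. 4.1.1/4.2.2, Greenberg 2006 Props. 3.2/4.1/4.2/§5 A,
BY NAME), `Module.IsTorsion Λ₂ X_Gr₂` (= `stub_torsionSS`), and two instance bricks: (R1a) `IsCofree ℤ_p
E[p^∞]` with a Tate-dual basis, (R1b) LOC_v⁽¹⁾ / `corank H⁰ = 0`. The sibling file `…CofreeTateDual` (this
seat) PROVES (R1a) outright (`SignedBaseChangeAcDivCofree.isCofree_primaryTorsion`,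
`exists_tateDual_basis_primaryTorsion`). THIS FILE plugs it in:

* `xGr₂_hasNoPseudoNullSubmodule_of_loc1` — p627602's first theorem WITHOUT `hcofree` / `hTate`;
* `xGr₂_torsionBy_X_finiteExponent_of_loc1` — p627602's second theorem (the stub's conclusion) WITHOUT
  `hcofree` / `hTate`;
* `finiteExponent_of_loc1` — the LEAD's TELESCOPE `SignedBaseChangeAcDivFiniteExponentTelescope.finiteExponent_of_bricks`
  (p628494: torsion derived inside from `lengthAt_(T₁) = 0`, the canonical `S = {w ∣ p} ∪ {bad}`, every
  descended `ρ₀`) WITHOUT `hcofree` / `hTate`: **the registered stub's conclusion ⟸ {6 PUB facts by name,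
  (R1b)}** and nothing else.

So the finite-exponent input of line `bdpline` now rests on: six typed PUB facts, `stub_torsionSS`, and the
ONE Galois-side brick (R1b) (determinant form of Greenberg 2010 Lemma 5.2.2; algebra landed p626784).
Theorems only; no definition, no named fact, no `sorry`. HONEST FRAMING: conditional on the displayed
hypotheses; closes nothing by itself (`--supports stmt-BirchSwinnertonDyer-20727`); no summit statement /
BSD is proved by this file.

References: [Greenberg2016Selmer] Prop. 4.1.1 (c) p. 15, §4.3 pp. 20–21; [Greenberg2006] Thm. 3 p. 342,
p. 338 L15–16; [SilvermanAEC2009] Cor. III.6.4, §VIII.2.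
-/

-- `Summit.BirchSwinnertonDyer.BirchSwinnertonDyer.…`: summit and sub-problem share a name (D-0017 layout).
set_option linter.dupNamespace false
set_option autoImplicit false

noncomputable section

open scoped Classical
open NumberField IsDedekindDomain Field
open Literature.NumberTheory.EllipticCurves Literature.NumberTheory.GaloisRepresentations
  Literature.NumberTheory.IwasawaTheory Literature.NumberTheory.IwasawaTheory.Greenberg2006
  Literature.NumberTheory.IwasawaTheory.Greenberg2016
  Summit.BirchSwinnertonDyer.BirchSwinnertonDyer.Theorems.SignedBaseChangeAcDivNoPseudoNull
  Summit.BirchSwinnertonDyer.BirchSwinnertonDyer.Theorems.SignedBaseChangeAcDivCofree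

namespace Summit.BirchSwinnertonDyer.BirchSwinnertonDyer.Theorems.SignedBaseChangeAcDivNoPseudoNullLOC1

variable {K : Type} [Field K] [NumberField K] {p : ℕ} [Fact p.Prime] (W : WeierstrassCurve K)
  [W.IsElliptic] (κ₁ κ₂ : ZpExtension K p) (vbar : HeightOneSpectrum (𝓞 K)) (γ₁ γ₂ : absoluteGaloisGroup K)
  [hγ : Fact (ZpExtension.IsTopGeneratorPair κ₁ κ₂ γ₁ γ₂)]

/-- **`X_Gr(E/K̃_∞)` has no non-zero pseudo-null `Λ₂`-submodule**, for an elliptic `W/K` over an imaginary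
quadratic `K` with `p > 2` split as `v v̄` and a generator pair, GRANTED the six PUBLISHED facts,
`Λ₂`-torsion of `X_Gr₂` and (R1b) LOC_v⁽¹⁾ / `corank H⁰ = 0` for every admissible `(S, ρ₀)` — brick (R1a)
(cofreeness of `E[p^∞]`, Tate-dual basis) being the sibling theorems `isCofree_primaryTorsion` /
`exists_tateDual_basis_primaryTorsion`. [cite: Greenberg2016Selmer, Prop. 4.1.1 (c) p. 15, §4.3 pp. 20–21]
[cite: Greenberg2006, Thm. 3 p. 342, p. 338 L15–16] -/
theorem xGr₂_hasNoPseudoNullSubmodule_of_loc1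
    (h411 : prop411_selmer_isAlmostDivisible) (h422 : prop422_localCohomology_isAlmostDivisible)
    (h5A : sec5A_localH2_subsingleton_of_LOC1) (h41 : prop41_globalEulerPoincareCorank)
    (h42 : prop42_localEulerPoincareCorank) (h32 : prop32_cohomology_isCofinitelyGenerated)
    (hp : 2 < p) (hK : IsImaginaryQuadratic K)
    {v : HeightOneSpectrum (𝓞 K)} (hv : ((p : ℕ) : 𝓞 K) ∈ v.asIdeal)
    (hvbar : ((p : ℕ) : 𝓞 K) ∈ vbar.asIdeal) (hne : vbar ≠ v)
    (htors : Module.IsTorsion (IwasawaAlgebra₂ p) (W.XGr₂ p κ₁ κ₂ vbar γ₁ γ₂))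
    (hR1b : ∀ [TopologicalSpace (PowerSeries ℤ_[p])] [TopologicalSpace (PowerSeries (PowerSeries ℤ_[p]))]
      [IsTopologicalRing (PowerSeries (PowerSeries ℤ_[p]))]
      [IsTopologicalAddGroup (IndModule₂ ℤ_[p] p (PrimaryTorsion W.geomPoints p))]
      [ContinuousSMul (PowerSeries (PowerSeries ℤ_[p])) (IndModule₂ ℤ_[p] p (PrimaryTorsion W.geomPoints p))]
      (S : Set (HeightOneSpectrum (𝓞 K)))
      (hS : ∀ w : HeightOneSpectrum (𝓞 K), ((p : ℕ) : 𝓞 K) ∈ w.asIdeal → w ∈ S)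
      (ρ₀ : ContinuousRep (GaloisGroupUnramifiedOutside K S) ℤ_[p] (PrimaryTorsion W.geomPoints p)),
      (∀ (σ : absoluteGaloisGroup K) (P : PrimaryTorsion W.geomPoints p), ρ₀ (toUnramifiedQuot K S σ) P = σ • P) →
      (∀ w : HeightOneSpectrum (𝓞 K), w ∈ S → LOC1 S (twistDeformation S hS κ₁ κ₂ ρ₀) (Sum.inr w)) ∧
      (∀ w : HeightOneSpectrum (𝓞 K), w ∈ S →
        HasCorank (IwasawaAlgebra₂ p) ((localRep S (twistDeformation S hS κ₁ κ₂ ρ₀) (Sum.inr w)).H 0) 0) ∧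
      HasCorank (IwasawaAlgebra₂ p) ((twistDeformation S hS κ₁ κ₂ ρ₀).H 0) 0) :
    HasNoPseudoNullSubmodule (IwasawaAlgebra₂ p) (W.XGr₂ p κ₁ κ₂ vbar γ₁ γ₂) :=
  xGr₂_hasNoPseudoNullSubmodule_of_bricks W κ₁ κ₂ vbar γ₁ γ₂ h411 h422 h5A h41 h42 h32 hp hK hv hvbar hne
    htors (isCofree_primaryTorsion W p) (exists_tateDual_basis_primaryTorsion W p) hR1b

/-- **Finite exponent of `X_Gr₂[T₁]` at `(T₁) ∉ Supp X_Gr₂`** (the conclusion of the registered stub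
`stub_finiteExponentSS` for an elliptic `W/K`), GRANTED the six PUBLISHED facts, `Λ₂`-torsion of `X_Gr₂` and
brick (R1b) only. [cite: Greenberg2016Selmer, Prop. 4.1.1 (c) p. 15] [cite: Greenberg2006, Thm. 3 p. 342] -/
theorem xGr₂_torsionBy_X_finiteExponent_of_loc1
    (h411 : prop411_selmer_isAlmostDivisible) (h422 : prop422_localCohomology_isAlmostDivisible)
    (h5A : sec5A_localH2_subsingleton_of_LOC1) (h41 : prop41_globalEulerPoincareCorank)
    (h42 : prop42_localEulerPoincareCorank) (h32 : prop32_cohomology_isCofinitelyGenerated)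
    (hp : 2 < p) (hK : IsImaginaryQuadratic K)
    {v : HeightOneSpectrum (𝓞 K)} (hv : ((p : ℕ) : 𝓞 K) ∈ v.asIdeal)
    (hvbar : ((p : ℕ) : 𝓞 K) ∈ vbar.asIdeal) (hne : vbar ≠ v)
    (htors : Module.IsTorsion (IwasawaAlgebra₂ p) (W.XGr₂ p κ₁ κ₂ vbar γ₁ γ₂))
    (hR1b : ∀ [TopologicalSpace (PowerSeries ℤ_[p])] [TopologicalSpace (PowerSeries (PowerSeries ℤ_[p]))]
      [IsTopologicalRing (PowerSeries (PowerSeries ℤ_[p]))]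
      [IsTopologicalAddGroup (IndModule₂ ℤ_[p] p (PrimaryTorsion W.geomPoints p))]
      [ContinuousSMul (PowerSeries (PowerSeries ℤ_[p])) (IndModule₂ ℤ_[p] p (PrimaryTorsion W.geomPoints p))]
      (S : Set (HeightOneSpectrum (𝓞 K)))
      (hS : ∀ w : HeightOneSpectrum (𝓞 K), ((p : ℕ) : 𝓞 K) ∈ w.asIdeal → w ∈ S)
      (ρ₀ : ContinuousRep (GaloisGroupUnramifiedOutside K S) ℤ_[p] (PrimaryTorsion W.geomPoints p)),
      (∀ (σ : absoluteGaloisGroup K) (P : PrimaryTorsion W.geomPoints p), ρ₀ (toUnramifiedQuot K S σ) P = σ • P) →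
      (∀ w : HeightOneSpectrum (𝓞 K), w ∈ S → LOC1 S (twistDeformation S hS κ₁ κ₂ ρ₀) (Sum.inr w)) ∧
      (∀ w : HeightOneSpectrum (𝓞 K), w ∈ S →
        HasCorank (IwasawaAlgebra₂ p) ((localRep S (twistDeformation S hS κ₁ κ₂ ρ₀) (Sum.inr w)).H 0) 0) ∧
      HasCorank (IwasawaAlgebra₂ p) ((twistDeformation S hS κ₁ κ₂ ρ₀).H 0) 0)
    (h0 : Literature.NumberTheory.EllipticCurves.Module.lengthAt (IwasawaAlgebra₂ p) (W.XGr₂ p κ₁ κ₂ vbar γ₁ γ₂)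
      ⟨Ideal.span {(PowerSeries.X : IwasawaAlgebra₂ p)}, PowerSeries.span_X_isPrime⟩ = 0) :
    ∃ m : ℕ, ∀ x : W.XGr₂ p κ₁ κ₂ vbar γ₁ γ₂, (PowerSeries.X : IwasawaAlgebra₂ p) • x = 0 →
      ((p : IwasawaAlgebra₂ p) ^ m) • x = 0 :=
  xGr₂_torsionBy_X_finiteExponent_of_bricks W κ₁ κ₂ vbar γ₁ γ₂ h411 h422 h5A h41 h42 h32 hp hK hv hvbar hne
    htors (isCofree_primaryTorsion W p) (exists_tateDual_basis_primaryTorsion W p) hR1b h0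

end Summit.BirchSwinnertonDyer.BirchSwinnertonDyer.Theorems.SignedBaseChangeAcDivNoPseudoNullLOC1

/-! ## §2 The LEAD's telescope with (R1a) discharged: the stub's conclusion from {6 PUB facts, (R1b)} -/

namespace Summit.BirchSwinnertonDyer.BirchSwinnertonDyer.Theorems.SignedBaseChangeAcDivFiniteExponentTelescopeLOC1

open Summit.BirchSwinnertonDyer.BirchSwinnertonDyer.Theorems.SignedBaseChangeAcDivFiniteExponentTelescope

variable {K : Type} [Field K] [NumberField K] {p : ℕ} [Fact p.Prime] (W : WeierstrassCurve K) [W.IsElliptic]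
  [TopologicalSpace (PowerSeries ℤ_[p])] [TopologicalSpace (PowerSeries (PowerSeries ℤ_[p]))]
  [IsTopologicalRing (PowerSeries (PowerSeries ℤ_[p]))]
  [IsTopologicalAddGroup (IndModule₂ ℤ_[p] p (PrimaryTorsion W.geomPoints p))]
  [ContinuousSMul (PowerSeries (PowerSeries ℤ_[p])) (IndModule₂ ℤ_[p] p (PrimaryTorsion W.geomPoints p))]
  (κ₁ κ₂ : ZpExtension K p) (vbar : HeightOneSpectrum (𝓞 K)) (γ₁ γ₂ : absoluteGaloisGroup K)
  [hγ : Fact (ZpExtension.IsTopGeneratorPair κ₁ κ₂ γ₁ γ₂)]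

/-- **The registered stub's conclusion (finite exponent of `X_Gr₂[T₁]` at `(T₁) ∉ Supp X_Gr₂`) for an
elliptic `W/K`, `K` imaginary quadratic, `p > 2` split as `v v̄`, a generator pair — GRANTED ONLY the six
PUBLISHED facts (Greenberg 2016 Props. 4.1.1 / 4.2.2, Greenberg 2006 Props. 3.2 / 4.1 / 4.2 / §5 A, by name)
and brick (R1b) (LOC_v⁽¹⁾ and `corank H⁰ = 0` for the canonical `S` and every descended `ρ₀`)**: the LEAD's
`finiteExponent_of_bricks` (p628494) with (R1a) supplied by `isCofree_primaryTorsion` /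
`exists_tateDual_basis_primaryTorsion` (p628727). [cite: Greenberg2016Selmer, Prop. 4.1.1 (c) p. 15, §4.3 pp. 20–21]
[cite: Greenberg2006, Thm. 3 p. 342, p. 338 L15–16] [cite: SilvermanAEC2009, Cor. III.6.4, §VIII.2] -/
theorem finiteExponent_of_loc1
    (h411 : prop411_selmer_isAlmostDivisible) (h422 : prop422_localCohomology_isAlmostDivisible)
    (h5A : sec5A_localH2_subsingleton_of_LOC1) (h41 : prop41_globalEulerPoincareCorank)
    (h42 : prop42_localEulerPoincareCorank) (h32 : prop32_cohomology_isCofinitelyGenerated)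
    (hp : 2 < p) (hK : IsImaginaryQuadratic K)
    {v : HeightOneSpectrum (𝓞 K)} (hv : ((p : ℕ) : 𝓞 K) ∈ v.asIdeal)
    (hvbar : ((p : ℕ) : 𝓞 K) ∈ vbar.asIdeal) (hne : vbar ≠ v)
    -- (R1b) for the canonical `S` and every descended `ρ₀`
    (hR1b : ∀ (ρ₀ : ContinuousRep
        (GaloisGroupUnramifiedOutside K {w : HeightOneSpectrum (𝓞 K) | ((p : ℕ) : 𝓞 K) ∈ w.asIdeal ∨ ¬ W.HasGoodReductionAt w})
        ℤ_[p] (PrimaryTorsion W.geomPoints p)),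
      (∀ (σ : absoluteGaloisGroup K) (P : PrimaryTorsion W.geomPoints p),
        ρ₀ (toUnramifiedQuot K _ σ) P = σ • P) →
      (∀ w : HeightOneSpectrum (𝓞 K), w ∈ {w : HeightOneSpectrum (𝓞 K) | ((p : ℕ) : 𝓞 K) ∈ w.asIdeal ∨ ¬ W.HasGoodReductionAt w} →
          LOC1 _ (twistDeformation _ (mem_badOrP_of_natCast_mem W p) κ₁ κ₂ ρ₀) (Sum.inr w)) ∧
        (∀ w : HeightOneSpectrum (𝓞 K), w ∈ {w : HeightOneSpectrum (𝓞 K) | ((p : ℕ) : 𝓞 K) ∈ w.asIdeal ∨ ¬ W.HasGoodReductionAt w} →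
          HasCorank (IwasawaAlgebra₂ p)
            ((localRep _ (twistDeformation _ (mem_badOrP_of_natCast_mem W p) κ₁ κ₂ ρ₀) (Sum.inr w)).H 0) 0) ∧
        HasCorank (IwasawaAlgebra₂ p)
          ((twistDeformation _ (mem_badOrP_of_natCast_mem W p) κ₁ κ₂ ρ₀).H 0) 0)
    (h0 : Literature.NumberTheory.EllipticCurves.Module.lengthAt (IwasawaAlgebra₂ p) (W.XGr₂ p κ₁ κ₂ vbar γ₁ γ₂)
      ⟨Ideal.span {(PowerSeries.X : IwasawaAlgebra₂ p)}, PowerSeries.span_X_isPrime⟩ = 0) :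
    ∃ m : ℕ, ∀ x : W.XGr₂ p κ₁ κ₂ vbar γ₁ γ₂,
      (PowerSeries.X : IwasawaAlgebra₂ p) • x = 0 → ((p : IwasawaAlgebra₂ p) ^ m) • x = 0 :=
  finiteExponent_of_bricks W κ₁ κ₂ vbar γ₁ γ₂ h411 h422 h5A h41 h42 h32 hp hK hv hvbar hne
    (isCofree_primaryTorsion W p) (exists_tateDual_basis_primaryTorsion W p) hR1b h0

end Summit.BirchSwinnertonDyer.BirchSwinnertonDyer.Theorems.SignedBaseChangeAcDivFiniteExponentTelescopeLOC1

end
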